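/-
Copyright (c) 2026 the pub-hodgecm-mathlib formalisation cell (harness21).  Prover seat hodgecm-mathlib-LH10-p01 (g12): road M6 → F5 → dyadic chain of `stub_DyUnramCore` (D-UNR),
research brick (L2-3)-θ «THE HERMITIAN CAYLEY SHIFT» — a 2-free Möbius shift losing exactly one level (MEMO-L23-θSHIFT v1); 2026-09-03.
-/
import Literature.NumberTheory.Automorphic.MatrixMoebiusShiftLevel   -- ★ N5a (F0P2-p02): the `|2| = 1` level lemma and `valued_pow_of_valued_eq_exp_neg_one`; brings ★ α `MatrixMoebiusShift` (the σ-fixed Cayley pair)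
import HarnessLib

/-!
# The hermitian Cayley shift `φ(g) = (a g + b)(σb·g + σa)⁻¹` and its 2-free level lemma with the pair `(a, b) = (θ, c − θ)`, `θ + σθ = 1` (Weyl 1939 II §10; Kottwitz 1986 §3)

Topic `NumberTheory/Automorphic`; namespace `Literature.NumberTheory.Automorphic.MoebiusShift`.  THEOREMS ONLY (no definition, no instance, no notation, no named fact, no `sorry`);
kernel lane `--supports stmt-HodgeConjecture-24833`.  Cell `pub/hodgecm-mathlib` (D-0151), crux H413 = `stmt-HodgeConjecture-24833`; road M6 → F5 → the dyadic chain of organ (D-UNR)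
`stub_DyUnramCore`, LEVEL TWO, site (L2-3) «THE WALL» (FINDING #7: «the level-two lift has no dyadic twin»): ★ N5a `valued_moebius_sub_one_le_of_level` shifts a level-(j+1)
element to level j by the σ-FIXED Cayley pair `(c+1, c−1)` — `φ_c(g) − 1 = 2(g−1)·D⁻¹`, `D = 2c·1 + (c−1)(g−1)` — and loses exactly one level only because `|2c| = |c|`, i.e. `|2| = 1`.
THIS FILE (research input MEMO-L23-θSHIFT v1 of this seat, count-neutral): the HERMITIAN Cayley form `φ(g) = (a·g + b·1)(σb·g + σa·1)⁻¹` preserves every `σ`-hermitian Gram identity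
for an ARBITRARY pair `(a, b)` (§1; ★ α §1 is the σ-fixed case), and with the pair `(a, b) = (θ, c − θ)` for an INTEGRAL `θ` with `θ + σθ = 1` (★ `UnramifiedLocalConjDatum.trace`,
every unramified quadratic extension of local fields, any residue characteristic) one has `N − D = (1 − c)(g − 1)` (§2) and the LEVEL LEMMA `g ≡ 1 (mod c^{j+1}) ⇒ φ(g), φ(g)⁻¹ ≡ 1
(mod c^j)` with NO hypothesis on `|2|` (§3) — ★ N5a's statement with `h2` DELETED and `(c+1, c−1)` replaced by `(θ, c−θ ∣ c−σθ, σθ)`.  Whether the rest of ★ `liftInterior_of_levelTwo`'s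
shift kit (N5b, N3, (A3), the S-rows) ports along the same substitution is the desk's to price; this file asserts only the algebra and the valuation estimate.
READ-BACK against ★ p851712 `MatrixMoebiusShiftLevelDyadic` (LH1-p01 (g11)): that file de-`h2`'s the σ-FIXED pair at DEEP levels under the sharp dominance `|c|^j < |2|`
(`j ≥ ord 2 + 1`) — enough for the «`∃ j`» nhds-basis consumer (★ `UnitaryCarrierCongruenceNhdsBasisDyadic`), not for the FIXED level `j = 1` of the level-two lift; the
`θ`-pair below carries no dominance hypothesis (every `j ≥ 1`, every `|2|`), at the price of a `σ`-SEMILINEAR (hermitian) rather than `σ`-fixed Cayley form.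
HONEST LABEL: HC_CM is proved only modulo the 7 printed citations (2 remaining named inputs: hLiu418 = stmt-HodgeConjecture-24832, h413 = stmt-HodgeConjecture-24833) until rung 0
closes; elementary matrix algebra over a commutative ring ∕ a valued field, count-neutral (zero label movement).

* §1 `transpose_map_smul_add_smul_one'`, **`gram_hermitianMoebius_eq`** (`ᵗσ(ag+b)·H·(ag+b) = ᵗσ(σb·g+σa)·H·(σb·g+σa)` when `ᵗσg·H·g = H`, `σ² = 1`),
  **`transpose_map_hermitianMoebius_mul_mul`** (`φ(g)` preserves `H`), `moebius_conj'` (conjugation equivariance, four scalars);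
* §2 `hermitianMoebius_numer_sub_denom` (`N − D = (1 − c)•(g − 1)` for `(θ, c − θ)`), `hermitianMoebius_denom_eq`, `hermitianMoebius_numer_eq` (`D = c•1 + (c−σθ)•E`, `N = c•1 + θ•E`);
* §3 `valued_det_and_inv_c_add` (`|det(c•1 + t•E)| = exp(−2)`, `|(·)⁻¹| ≤ exp(1)` — ★ N5a's with `2c ↦ c`), **`valued_hermitianMoebius_sub_one_le_of_level`** (THE 2-FREE LEVEL LEMMA).
* §4 (ED. 2) the `1 × 1` twins: `genMoebius_scalar_inverse_comp` (`φ∘ψ = id` on scalars), **`valued_hermitianMoebius_scalar_sub_one_le_of_level`** (★ N5a's scalar lemma minus `h2`),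
  **`valued_inverseHermitianMoebius_scalar_sub_one_le_of_level`** (the inverse scalar shift GAINS a level).

## References
* [Weyl1939] H. Weyl, *The Classical Groups* (1939): Chap. II §10 (Cayley's rational parametrisation of the unitary group).
* [Kottwitz1986BaseChangeUnits] R. E. Kottwitz, *Base change for unit elements of Hecke algebras*, Compositio Math. 60 (1986): §2 pp. 244–247 (the shifted order, one level down).
* [Rogawski1990] J. D. Rogawski, *Automorphic Representations of Unitary Groups in Three Variables* (1990): §4.9 Prop. 4.9.1 (b) p. 55.
* [SerreLocalFields1979] J.-P. Serre, *Local Fields*, GTM 67 (1979): Ch. I §§1–2; Ch. V §2 (the trace of an unramified extension is onto).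
-/

set_option autoImplicit false

noncomputable section

open Matrix Polynomial
open scoped WithZero

namespace Literature.NumberTheory.Automorphic.MoebiusShift

/-! ## §1 The hermitian Cayley form over a commutative ring -/

section Ring

variable {R : Type*} [CommRing R] {n : Type*} [Fintype n] [DecidableEq n]

omit [Fintype n] in
/-- The `σ`-adjoint of `a·M + b·1` for arbitrary `a, b`: `ᵗσ(aM + b) = σa·ᵗσM + σb·1`. [cite: Weyl1939, Chap. II §10] -/
theorem transpose_map_smul_add_smul_one' (σ : R →+* R) (M : Matrix n n R) (a b : R) :
    ((a • M + b • (1 : Matrix n n R)).map σ)ᵀ = σ a • (M.map σ)ᵀ + σ b • 1 := by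
  ext i j
  rcases eq_or_ne i j with h | h
  · subst h; simp [Matrix.map_apply]
  · simp [Matrix.map_apply, h, h.symm]

/-- **The two sides of the HERMITIAN shift have the same Gram matrix on a form preserved by `M`**: for an involution `σ`, `ᵗ(σM)·H·M = H` and ANY `a, b`,
`ᵗσ(aM+b)·H·(aM+b) = ᵗσ(σb·M+σa)·H·(σb·M+σa)` (both equal `(aσa + bσb)H + bσa·ᵗ(σM)H + aσb·HM`). [cite: Weyl1939, Chap. II §10] -/
theorem gram_hermitianMoebius_eq (σ : R →+* R) (hσ : ∀ x, σ (σ x) = x) (H M : Matrix n n R) (hM : (M.map σ)ᵀ * H * M = H) (a b : R) :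
    ((a • M + b • (1 : Matrix n n R)).map σ)ᵀ * H * (a • M + b • 1) = ((σ b • M + σ a • (1 : Matrix n n R)).map σ)ᵀ * H * (σ b • M + σ a • 1) := by
  rw [transpose_map_smul_add_smul_one' σ M a b, transpose_map_smul_add_smul_one' σ M (σ b) (σ a), hσ, hσ]
  simp only [add_mul, mul_add, smul_mul_assoc, mul_smul_comm, Matrix.one_mul, Matrix.mul_one, smul_smul, smul_add, hM]
  abel_nf
  simp only [mul_comm (σ a) a, mul_comm (σ b) b, mul_comm (σ a) b, mul_comm (σ b) a]
  abel

/-- **The hermitian shift preserves the form**: `ᵗ(σM)·H·M = H`, `σ² = 1`, `det(σb·M + σa)` a unit ⇒ `Y := (aM+b)(σb·M+σa)⁻¹` satisfies `ᵗ(σY)·H·Y = H`. [cite: Weyl1939, Chap. II §10] -/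
theorem transpose_map_hermitianMoebius_mul_mul (σ : R →+* R) (hσ : ∀ x, σ (σ x) = x) (H M : Matrix n n R) (hM : (M.map σ)ᵀ * H * M = H) (a b : R)
    (hD : IsUnit (σ b • M + σ a • (1 : Matrix n n R)).det) :
    (((a • M + b • (1 : Matrix n n R)) * (σ b • M + σ a • (1 : Matrix n n R))⁻¹).map σ)ᵀ * H * ((a • M + b • 1) * (σ b • M + σ a • 1)⁻¹) = H := by
  set D : Matrix n n R := σ b • M + σ a • 1 with hDdef
  set N : Matrix n n R := a • M + b • 1 with hNdef
  have hkey : (N.map σ)ᵀ * H * N = (D.map σ)ᵀ * H * D := gram_hermitianMoebius_eq σ hσ H M hM a b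
  have h1 : D * D⁻¹ = 1 := Matrix.mul_nonsing_inv D hD
  have h2 : (D⁻¹.map σ)ᵀ * (D.map σ)ᵀ = 1 := by
    rw [← Matrix.transpose_mul, ← Matrix.map_mul, h1, Matrix.map_one σ (map_zero σ) (map_one σ), Matrix.transpose_one]
  calc ((N * D⁻¹).map σ)ᵀ * H * (N * D⁻¹)
      = (D⁻¹.map σ)ᵀ * ((N.map σ)ᵀ * H * N) * D⁻¹ := by
        rw [Matrix.map_mul, Matrix.transpose_mul]; simp only [Matrix.mul_assoc]
    _ = (D⁻¹.map σ)ᵀ * (D.map σ)ᵀ * (H * (D * D⁻¹)) := by rw [hkey]; simp only [Matrix.mul_assoc]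
    _ = H := by rw [h2, h1, Matrix.mul_one, Matrix.one_mul]

/-- **Conjugation equivariance, four scalars**: `(x(PMP⁻¹) + y)(z(PMP⁻¹) + w)⁻¹ = P·((xM + y)(zM + w)⁻¹)·P⁻¹`. [cite: HornJohnson2013, §0.8.2] -/
theorem moebius_conj' (P M : Matrix n n R) (hP : IsUnit P.det) (x y z w : R) (hD : IsUnit (z • M + w • (1 : Matrix n n R)).det) :
    (x • (P * M * P⁻¹) + y • (1 : Matrix n n R)) * (z • (P * M * P⁻¹) + w • (1 : Matrix n n R))⁻¹ =
      P * ((x • M + y • 1) * (z • M + w • 1)⁻¹) * P⁻¹ := by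
  have hlin : ∀ s t : R, s • (P * M * P⁻¹) + t • (1 : Matrix n n R) = P * (s • M + t • 1) * P⁻¹ := fun s t => by
    rw [mul_add, add_mul, mul_smul_comm, smul_mul_assoc, mul_smul_comm, smul_mul_assoc, Matrix.mul_one, Matrix.mul_nonsing_inv P hP]
  have hinv : (P * (z • M + w • 1) * P⁻¹)⁻¹ = P * (z • M + w • 1)⁻¹ * P⁻¹ := by
    refine Matrix.inv_eq_right_inv ?_
    calc P * (z • M + w • 1) * P⁻¹ * (P * (z • M + w • 1)⁻¹ * P⁻¹)
        = P * ((z • M + w • 1) * ((P⁻¹ * P) * (z • M + w • 1)⁻¹)) * P⁻¹ := by simp only [Matrix.mul_assoc]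
      _ = 1 := by rw [Matrix.nonsing_inv_mul P hP, Matrix.one_mul, Matrix.mul_nonsing_inv _ hD, Matrix.mul_one, Matrix.mul_nonsing_inv P hP]
  rw [hlin, hlin, hinv]
  calc P * (x • M + y • 1) * P⁻¹ * (P * (z • M + w • 1)⁻¹ * P⁻¹)
      = P * ((x • M + y • 1) * ((P⁻¹ * P) * (z • M + w • 1)⁻¹)) * P⁻¹ := by simp only [Matrix.mul_assoc]
    _ = P * ((x • M + y • 1) * (z • M + w • 1)⁻¹) * P⁻¹ := by rw [Matrix.nonsing_inv_mul P hP, Matrix.one_mul]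

/-! ## §2 The pair `(θ, c − θ)`: numerator minus denominator is `(1 − c)(g − 1)` -/

omit [Fintype n] in
/-- **`N − D = (1 − c)·(g − 1)`** for `N = θ•g + (c−θ)•1`, `D = (c−σθ)•g + σθ•1`, `θ + σθ = 1` — no factor `2`. [cite: Kottwitz1986BaseChangeUnits, §2 pp. 244–247] -/
theorem hermitianMoebius_numer_sub_denom (σ : R →+* R) {θ : R} (hθ : θ + σ θ = 1) (c : R) (g : Matrix n n R) :
    (θ • g + (c - θ) • (1 : Matrix n n R)) - ((c - σ θ) • g + σ θ • (1 : Matrix n n R)) = (1 - c) • (g - 1) := by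
  have hσθ : σ θ = 1 - θ := by linear_combination hθ
  rw [hσθ]
  module

omit [Fintype n] in
/-- The denominator at `g = 1 + E`: `D = c•1 + (c − σθ)•E`. [cite: Kottwitz1986BaseChangeUnits, §2 pp. 244–247] -/
theorem hermitianMoebius_denom_eq (σ : R →+* R) (θ c : R) (E : Matrix n n R) :
    (c - σ θ) • (1 + E) + σ θ • (1 : Matrix n n R) = c • (1 : Matrix n n R) + (c - σ θ) • E := by
  module

omit [Fintype n] in
/-- The numerator at `g = 1 + E`: `N = c•1 + θ•E`. [cite: Kottwitz1986BaseChangeUnits, §2 pp. 244–247] -/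
theorem hermitianMoebius_numer_eq (θ c : R) (E : Matrix n n R) :
    θ • (1 + E) + (c - θ) • (1 : Matrix n n R) = c • (1 : Matrix n n R) + θ • E := by
  module

end Ring

/-! ## §3 The 2-free level lemma over a valued field -/

section Level

variable {K : Type*} [Field K] [Valued K ℤᵐ⁰]

/-- **The denominator near `1`, 2-free**: for `M = c·1 + t·E` (`2 × 2`, `|t| ≤ 1`, `|E_{ab}| ≤ |c|^{j+1}`, `j ≥ 1`, `|c| = exp(−1)`): `|det M| = exp(−2)` and `|(M⁻¹)_{ab}| ≤ exp(1)`
— ★ N5a `valued_det_and_inv_two_c_add` with `2c ↦ c`, `h2` deleted. [cite: Kottwitz1986BaseChangeUnits, §2 pp. 244–247] [cite: SerreLocalFields1979, Ch. I §§1–2] -/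
theorem valued_det_and_inv_c_add {c : K} (hc : Valued.v c = WithZero.exp (-1 : ℤ)) {t : K} (ht : Valued.v t ≤ 1)
    {E : Matrix (Fin 2) (Fin 2) K} {j : ℕ} (hj : 1 ≤ j) (hE : ∀ a b, Valued.v (E a b) ≤ Valued.v c ^ (j + 1)) :
    Valued.v ((c • (1 : Matrix (Fin 2) (Fin 2) K) + t • E).det) = WithZero.exp (-2 : ℤ) ∧
      ∀ a b, Valued.v (((c • (1 : Matrix (Fin 2) (Fin 2) K) + t • E)⁻¹) a b) ≤ WithZero.exp (1 : ℤ) := by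
  set M : Matrix (Fin 2) (Fin 2) K := c • (1 : Matrix (Fin 2) (Fin 2) K) + t • E with hM
  have hcpow := valued_pow_of_valued_eq_exp_neg_one hc (j + 1)
  have hsmall : ∀ a b, Valued.v (t * E a b) < WithZero.exp (-1 : ℤ) := fun a b => by
    rw [map_mul]
    calc Valued.v t * Valued.v (E a b) ≤ 1 * Valued.v c ^ (j + 1) := mul_le_mul' ht (hE a b)
      _ = WithZero.exp (-((j + 1 : ℕ) : ℤ)) := by rw [one_mul, hcpow]
      _ < WithZero.exp (-1 : ℤ) := by rw [WithZero.exp_lt_exp]; omega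
  have hdiag : ∀ a, Valued.v (M a a) = WithZero.exp (-1 : ℤ) := fun a => by
    have e : M a a = c + t * E a a := by simp [hM, Matrix.add_apply, Matrix.smul_apply, Matrix.one_apply_eq]
    rw [e, Valuation.map_add_eq_of_lt_left _ (by rw [hc]; exact hsmall a a), hc]
  have hoff : ∀ a b, a ≠ b → Valued.v (M a b) < WithZero.exp (-1 : ℤ) := fun a b hab => by
    have e : M a b = t * E a b := by simp [hM, Matrix.add_apply, Matrix.smul_apply, Matrix.one_apply_ne hab]
    rw [e]; exact hsmall a b
  have hall : ∀ a b, Valued.v (M a b) ≤ WithZero.exp (-1 : ℤ) := fun a b => by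
    by_cases hab : a = b
    · subst hab; exact (hdiag a).le
    · exact (hoff a b hab).le
  have hdet : Valued.v M.det = WithZero.exp (-2 : ℤ) := by
    rw [Matrix.det_fin_two]
    have hmain : Valued.v (M 0 0 * M 1 1) = WithZero.exp (-2 : ℤ) := by
      rw [map_mul, hdiag, hdiag, ← WithZero.exp_add]; norm_num
    have hsub : Valued.v (M 0 1 * M 1 0) < Valued.v (M 0 0 * M 1 1) := by
      rw [hmain, map_mul, mul_comm]
      calc Valued.v (M 1 0) * Valued.v (M 0 1) < WithZero.exp (-1 : ℤ) * WithZero.exp (-1 : ℤ) :=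
            mul_lt_mul_of_le_of_lt_of_nonneg_of_pos (hall 1 0) (hoff 0 1 (by decide)) zero_le (zero_lt_iff.2 WithZero.exp_ne_zero)
        _ = WithZero.exp (-2 : ℤ) := by rw [← WithZero.exp_add]; norm_num
    rw [Valuation.map_sub_eq_of_lt_left _ hsub, hmain]
  refine ⟨hdet, fun a b => ?_⟩
  have hadj : ∀ a b, Valued.v (M.adjugate a b) ≤ WithZero.exp (-1 : ℤ) := fun a b => by
    rw [Matrix.adjugate_fin_two]
    fin_cases a <;> fin_cases b
    · simpa using hall 1 1
    · simpa using hall 0 1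
    · simpa using hall 1 0
    · simpa using hall 0 0
  rw [Matrix.inv_def, Matrix.smul_apply, smul_eq_mul, Ring.inverse_eq_inv', map_mul, map_inv₀, hdet, ← WithZero.exp_neg, neg_neg]
  calc WithZero.exp (2 : ℤ) * Valued.v (M.adjugate a b) ≤ WithZero.exp (2 : ℤ) * WithZero.exp (-1 : ℤ) := mul_le_mul' le_rfl (hadj a b)
    _ = WithZero.exp (1 : ℤ) := by rw [← WithZero.exp_add]; norm_num

/-- **THE 2-FREE LEVEL LEMMA — A LEVEL-`(j+1)` ELEMENT SHIFTS TO A LEVEL-`j` ELEMENT under the hermitian Cayley shift with the pair `(θ, c − θ)`** (`2 × 2`): for an INTEGRAL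
`θ` with `θ + σθ = 1` (any residue characteristic), `|c| = exp(−1)` and `g ≡ 1 (mod c^{j+1})` entrywise, `j ≥ 1`:
`φ(g) := (θ•g + (c−θ)•1)((c−σθ)•g + σθ•1)⁻¹` has `φ(g) − 1 ≡ 0` and `φ(g)⁻¹ − 1 ≡ 0 (mod c^j)` entrywise (`φ(g) − 1 = (1−c)(g−1)·D⁻¹`, `φ(g)⁻¹ − 1 = −(1−c)(g−1)·N⁻¹`,
`D = c•1 + (c−σθ)•(g−1)`, `N = c•1 + θ•(g−1)`).  ★ N5a `valued_moebius_sub_one_le_of_level` is the `|2| = 1` pair `(c+1, c−1)`; here NO hypothesis on `|2|`.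
[cite: Kottwitz1986BaseChangeUnits, §2 pp. 244–247] [cite: Rogawski1990, §4.9 Prop. 4.9.1 (b) p. 55] [cite: SerreLocalFields1979, Ch. V §2] -/
theorem valued_hermitianMoebius_sub_one_le_of_level (σ : K →+* K) {θ : K} (hθ : θ + σ θ = 1) (hθv : Valued.v θ ≤ 1) {c : K} (hc : Valued.v c = WithZero.exp (-1 : ℤ))
    (g : Matrix (Fin 2) (Fin 2) K) {j : ℕ} (hj : 1 ≤ j) (hg : ∀ a b, Valued.v ((g - 1) a b) ≤ Valued.v c ^ (j + 1)) :
    (∀ a b, Valued.v (((θ • g + (c - θ) • (1 : Matrix (Fin 2) (Fin 2) K)) * ((c - σ θ) • g + σ θ • (1 : Matrix (Fin 2) (Fin 2) K))⁻¹ - 1) a b) ≤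
        Valued.v c ^ j) ∧
      ∀ a b, Valued.v ((((θ • g + (c - θ) • (1 : Matrix (Fin 2) (Fin 2) K)) * ((c - σ θ) • g + σ θ • (1 : Matrix (Fin 2) (Fin 2) K))⁻¹)⁻¹ - 1) a b) ≤
        Valued.v c ^ j := by
  have hσθ : σ θ = 1 - θ := by linear_combination hθ
  have hσθv : Valued.v (σ θ) ≤ 1 := by rw [hσθ]; exact (Valuation.map_sub _ _ _).trans (max_le (by rw [map_one]) hθv)
  have hc1 : Valued.v c < 1 := by rw [hc, ← WithZero.exp_zero]; exact WithZero.exp_lt_exp.2 (by norm_num)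
  have h1c : Valued.v (1 - c) = 1 := by
    rw [Valuation.map_sub_eq_of_lt_left _ (show Valued.v c < Valued.v (1 : K) by rw [map_one]; exact hc1), map_one]
  have htD : Valued.v (c - σ θ) ≤ 1 := (Valuation.map_sub _ _ _).trans (max_le hc1.le hσθv)
  set E : Matrix (Fin 2) (Fin 2) K := g - 1 with hE
  have hgE : g = 1 + E := by rw [hE, add_sub_cancel]
  -- the two denominators in the `c•1 + t•E` form
  have hD : (c - σ θ) • g + σ θ • (1 : Matrix (Fin 2) (Fin 2) K) = c • (1 : Matrix (Fin 2) (Fin 2) K) + (c - σ θ) • E := by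
    rw [hgE]; exact hermitianMoebius_denom_eq σ θ c E
  have hN : θ • g + (c - θ) • (1 : Matrix (Fin 2) (Fin 2) K) = c • (1 : Matrix (Fin 2) (Fin 2) K) + θ • E := by
    rw [hgE]; exact hermitianMoebius_numer_eq θ c E
  have hNsubD : (θ • g + (c - θ) • (1 : Matrix (Fin 2) (Fin 2) K)) - ((c - σ θ) • g + σ θ • (1 : Matrix (Fin 2) (Fin 2) K)) = (1 - c) • E :=
    hermitianMoebius_numer_sub_denom σ hθ c g
  obtain ⟨hdetD, hinvD⟩ := valued_det_and_inv_c_add hc htD hj hg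
  obtain ⟨hdetN, hinvN⟩ := valued_det_and_inv_c_add hc hθv hj hg
  rw [hD, hN] at hNsubD ⊢
  set D : Matrix (Fin 2) (Fin 2) K := c • (1 : Matrix (Fin 2) (Fin 2) K) + (c - σ θ) • E with hDdef
  set N : Matrix (Fin 2) (Fin 2) K := c • (1 : Matrix (Fin 2) (Fin 2) K) + θ • E with hNdef
  have hDu : IsUnit D.det := isUnit_iff_ne_zero.2 fun h => by rw [h, map_zero] at hdetD; exact WithZero.zero_ne_coe hdetD
  have hNu : IsUnit N.det := isUnit_iff_ne_zero.2 fun h => by rw [h, map_zero] at hdetN; exact WithZero.zero_ne_coe hdetN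
  have hcpow := valued_pow_of_valued_eq_exp_neg_one hc
  -- entry bound for `((1 − c)•E) * M⁻¹`
  have hbound : ∀ {Mi : Matrix (Fin 2) (Fin 2) K}, (∀ a b, Valued.v (Mi a b) ≤ WithZero.exp (1 : ℤ)) →
      ∀ a b, Valued.v ((((1 - c) • E) * Mi) a b) ≤ Valued.v c ^ j := by
    intro Mi hMi a b
    rw [Matrix.mul_apply]
    refine Valuation.map_sum_le _ fun k _ => ?_
    rw [Matrix.smul_apply, smul_eq_mul, map_mul, map_mul, h1c, one_mul, hcpow j]
    calc Valued.v (E a k) * Valued.v (Mi k b) ≤ Valued.v c ^ (j + 1) * WithZero.exp (1 : ℤ) := mul_le_mul' (hg a k) (hMi k b)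
      _ = WithZero.exp (-(j : ℤ)) := by rw [hcpow (j + 1), ← WithZero.exp_add]; congr 1; push_cast; ring
  refine ⟨fun a b => ?_, fun a b => ?_⟩
  · have e : N * D⁻¹ - 1 = ((1 - c) • E) * D⁻¹ := by
      rw [← hNsubD, sub_mul, Matrix.mul_nonsing_inv D hDu]
    rw [e]
    exact hbound hinvD a b
  · have e : (N * D⁻¹)⁻¹ - 1 = -((((1 - c) • E)) * N⁻¹) := by
      rw [Matrix.mul_inv_rev, Matrix.nonsing_inv_nonsing_inv D hDu, ← hNsubD, ← neg_mul, neg_sub, sub_mul, Matrix.mul_nonsing_inv N hNu]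
    rw [e, Matrix.neg_apply, Valuation.map_neg]
    exact hbound hinvN a b

end Level

/-! ## §4 The scalar (`1 × 1`) shift: level, inverse level, `φ ∘ ψ = id` — ED. 2 -/

section Scalar

variable {K : Type*} [Field K]

/-- **The inverse pair undoes the scalar shift**: `(aψ + b)∕(b′ψ + a′) = h` for `ψ = (a′h − b)∕(−b′h + a)`, `aa′ − bb′ ≠ 0`, `−b′h + a ≠ 0`. [cite: Weyl1939, Chap. II §10] -/
theorem genMoebius_scalar_inverse_comp (a b a' b' h : K) (hΔ : a * a' - b * b' ≠ 0) (hD : -b' * h + a ≠ 0) :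
    (a * ((a' * h - b) / (-b' * h + a)) + b) / (b' * ((a' * h - b) / (-b' * h + a)) + a') = h := by
  have hden : b' * ((a' * h - b) / (-b' * h + a)) + a' = (a * a' - b * b') / (-b' * h + a) := by
    rw [mul_div_assoc', div_add' _ _ _ hD]; congr 1; ring
  have hnum : a * ((a' * h - b) / (-b' * h + a)) + b = (a * a' - b * b') * h / (-b' * h + a) := by
    rw [mul_div_assoc', div_add' _ _ _ hD]; congr 1; ring
  rw [hden, hnum, div_div_div_cancel_right₀ hD, mul_div_cancel_left₀ h hΔ]

variable [Valued K ℤᵐ⁰]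

/-- **THE 2-FREE SCALAR LEVEL LEMMA** (`1 × 1` twin of `valued_hermitianMoebius_sub_one_le_of_level`; ★ N5a `valued_moebius_scalar_sub_one_le_of_level` minus `h2`): for `θ` integral
with `θ + σθ = 1`, `|c| = exp(−1)`, `j ≥ 1`, `u ≡ 1 (mod c^{j+1})`: `φu := (θu + (c−θ))∕((c−σθ)u + σθ)` has `|φu − 1| ≤ |c|^j` and `|(φu)⁻¹ − 1| ≤ |c|^j`
(`N − D = (1−c)(u−1)`, `|N| = |D| = |c|`). [cite: Kottwitz1986BaseChangeUnits, §2 pp. 244–247] [cite: Rogawski1990, §4.9 Prop. 4.9.1 (b) p. 55] -/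
theorem valued_hermitianMoebius_scalar_sub_one_le_of_level (σ : K →+* K) {θ : K} (hθ : θ + σ θ = 1) (hθv : Valued.v θ ≤ 1) {c : K}
    (hc : Valued.v c = WithZero.exp (-1 : ℤ)) (u : K) {j : ℕ} (hj : 1 ≤ j) (hu : Valued.v (u - 1) ≤ Valued.v c ^ (j + 1)) :
    Valued.v ((θ * u + (c - θ)) / ((c - σ θ) * u + σ θ) - 1) ≤ Valued.v c ^ j ∧
      Valued.v (((θ * u + (c - θ)) / ((c - σ θ) * u + σ θ))⁻¹ - 1) ≤ Valued.v c ^ j := by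
  have hσθ : σ θ = 1 - θ := by linear_combination hθ
  have hσθv : Valued.v (σ θ) ≤ 1 := by rw [hσθ]; exact (Valuation.map_sub _ _ _).trans (max_le (by rw [map_one]) hθv)
  have hc1 : Valued.v c < 1 := by rw [hc, ← WithZero.exp_zero]; exact WithZero.exp_lt_exp.2 (by norm_num)
  have hc0 : Valued.v c ≠ 0 := by rw [hc]; exact WithZero.exp_ne_zero
  have h1c : Valued.v (1 - c) = 1 := by
    rw [Valuation.map_sub_eq_of_lt_left _ (show Valued.v c < Valued.v (1 : K) by rw [map_one]; exact hc1), map_one]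
  have htD : Valued.v (c - σ θ) ≤ 1 := (Valuation.map_sub _ _ _).trans (max_le hc1.le hσθv)
  have hcj : Valued.v c ^ (j + 1) < Valued.v c := by
    calc Valued.v c ^ (j + 1) ≤ Valued.v c ^ 2 := pow_le_pow_right_of_le_one' hc1.le (by omega)
      _ < Valued.v c := by rw [pow_two]; exact mul_lt_of_lt_one_left (zero_lt_iff.2 hc0) hc1
  have hsmall : ∀ {t : K}, Valued.v t ≤ 1 → Valued.v (t * (u - 1)) < Valued.v c := fun {t} ht => by
    rw [map_mul]; exact lt_of_le_of_lt (mul_le_of_le_one_left' ht) (hu.trans_lt hcj)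
  have eD : (c - σ θ) * u + σ θ = c + (c - σ θ) * (u - 1) := by ring
  have eN : θ * u + (c - θ) = c + θ * (u - 1) := by ring
  have hvD : Valued.v ((c - σ θ) * u + σ θ) = Valued.v c := by rw [eD, Valuation.map_add_eq_of_lt_left _ (hsmall htD)]
  have hvN : Valued.v (θ * u + (c - θ)) = Valued.v c := by rw [eN, Valuation.map_add_eq_of_lt_left _ (hsmall hθv)]
  have hD0 : (c - σ θ) * u + σ θ ≠ 0 := fun h => hc0 (by rw [← hvD, h, map_zero])
  have hN0 : θ * u + (c - θ) ≠ 0 := fun h => hc0 (by rw [← hvN, h, map_zero])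
  have hND : (θ * u + (c - θ)) - ((c - σ θ) * u + σ θ) = (1 - c) * (u - 1) := by rw [hσθ]; ring
  have key : Valued.v ((1 - c) * (u - 1)) * (Valued.v c)⁻¹ ≤ Valued.v c ^ j := by
    rw [map_mul, h1c, one_mul]
    calc Valued.v (u - 1) * (Valued.v c)⁻¹ ≤ Valued.v c ^ (j + 1) * (Valued.v c)⁻¹ := mul_le_mul' hu le_rfl
      _ = Valued.v c ^ j := by rw [pow_succ, mul_assoc, mul_inv_cancel₀ hc0, mul_one]
  constructor
  · rw [div_sub_one hD0, hND, map_div₀, hvD, div_eq_mul_inv]; exact key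
  · rw [inv_div, div_sub_one hN0, ← neg_sub, hND, map_div₀, Valuation.map_neg, hvN, div_eq_mul_inv]; exact key

/-- **THE INVERSE SCALAR SHIFT GAINS A LEVEL**: for `θ` integral with `θ + σθ = 1`, `σ` isometric, `|c| < 1`, `j ≥ 1`, `|h − 1| ≤ |c|^j`:
`ψh := (σθ·h + (θ−c))∕((σθ−c)h + θ)` has `|ψh − 1| ≤ |c|^{j+1}` and `|(ψh)⁻¹ − 1| ≤ |c|^{j+1}` (`N′ − D′ = c(h−1)`, `|N′| = |D′| = |1 − c| = 1`).
[cite: Kottwitz1986BaseChangeUnits, §2 pp. 244–247] [cite: Rogawski1990, §4.9 Prop. 4.9.1 (b) p. 55] -/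
theorem valued_inverseHermitianMoebius_scalar_sub_one_le_of_level (σ : K →+* K) (hσ : ∀ x, Valued.v (σ x) = Valued.v x) {θ : K} (hθ : θ + σ θ = 1)
    (hθv : Valued.v θ ≤ 1) {c : K} (hc : Valued.v c < 1) (h : K) {j : ℕ} (hj : 1 ≤ j) (hh : Valued.v (h - 1) ≤ Valued.v c ^ j) :
    Valued.v ((σ θ * h + (θ - c)) / ((σ θ - c) * h + θ) - 1) ≤ Valued.v c ^ (j + 1) ∧
      Valued.v (((σ θ * h + (θ - c)) / ((σ θ - c) * h + θ))⁻¹ - 1) ≤ Valued.v c ^ (j + 1) := by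
  have hσθv : Valued.v (σ θ) ≤ 1 := by rw [hσ]; exact hθv
  have h1c : Valued.v (1 - c) = 1 := Valuation.map_one_sub_of_lt _ hc
  have htD : Valued.v (σ θ - c) ≤ 1 := (Valuation.map_sub _ _ _).trans (max_le hσθv hc.le)
  have hf1 : Valued.v (h - 1) < 1 := hh.trans_lt (pow_lt_one₀ zero_le hc (by omega))
  have hsmall : ∀ {t : K}, Valued.v t ≤ 1 → Valued.v (t * (h - 1)) < Valued.v (1 - c) := fun {t} ht => by
    rw [map_mul, h1c]; exact lt_of_le_of_lt (mul_le_of_le_one_left' ht) hf1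
  have eD : (σ θ - c) * h + θ = (1 - c) + (σ θ - c) * (h - 1) := by linear_combination hθ
  have eN : σ θ * h + (θ - c) = (1 - c) + σ θ * (h - 1) := by linear_combination hθ
  have hvD : Valued.v ((σ θ - c) * h + θ) = 1 := by rw [eD, Valuation.map_add_eq_of_lt_left _ (hsmall htD), h1c]
  have hvN : Valued.v (σ θ * h + (θ - c)) = 1 := by rw [eN, Valuation.map_add_eq_of_lt_left _ (hsmall hσθv), h1c]
  have hD0 : (σ θ - c) * h + θ ≠ 0 := fun h0 => by rw [h0, map_zero] at hvD; exact zero_ne_one hvD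
  have hN0 : σ θ * h + (θ - c) ≠ 0 := fun h0 => by rw [h0, map_zero] at hvN; exact zero_ne_one hvN
  have hND : (σ θ * h + (θ - c)) - ((σ θ - c) * h + θ) = c * (h - 1) := by ring
  have key : Valued.v (c * (h - 1)) ≤ Valued.v c ^ (j + 1) := by
    rw [map_mul, pow_succ']; exact mul_le_mul' le_rfl hh
  constructor
  · rw [div_sub_one hD0, hND, map_div₀, hvD, div_one]; exact key
  · rw [inv_div, div_sub_one hN0, ← neg_sub, hND, map_div₀, Valuation.map_neg, hvN, div_one]; exact key

end Scalar

end Literature.NumberTheory.Automorphic.MoebiusShift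

end
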